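import Mathlib
import HarnessLib
import Literature.Analysis.FluidPDE.TypeIAncientMild
import Summits.NavierStokesRegularity.NavierStokesRegularity.Theorems.LocalHelicityTubeDoorFrobeniusProfileRigiditySharper
import Summits.NavierStokesRegularity.NavierStokesRegularity.Theorems.LocalHelicityTubeDoorFrobeniusProfileRigidityScrewSlice
import Summits.NavierStokesRegularity.NavierStokesRegularity.Theorems.AdaptedFrequencyFrequencyRigidityLiouvilleImpliesTypeI

/-!
# Door S11 `LocalTubeDoorHelicity`, crux K2⁗ `FrobeniusProfileRigidity` (stmt-NavierStokesRegularity-19975) —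
# NORMAL FORM OF THE REGISTERED STUB `stub_sliceQuadrichotomy`: the slice quadrichotomy S12 IS the Liouville
# theorem for the helicity-free Type-I ancient mild class, and sits below (L′) ⊂ (L)

Cell ns-regularity-ideate, stub-worker `ns-helicity-19975-w1` under the K2⁗ lead nsreg-p6 (skeleton v1 =
`Lines_birth_v1.lean`, sha16 f21e75c70c26ae96, ONE open registered stub `stub_sliceQuadrichotomy : SliceQuadrichotomy`;
lands `--supports stmt-NavierStokesRegularity-19975`; no claim).

The registered stub reads (bodies of the skeleton's `FrobeniusClass`, `HasScrewVorticityBall`, `SliceQuadrichotomy`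
written out verbatim — no definition is introduced here): every profile `v` of the Type-I class (rate `C/√(−t)`,
continuity on the open slab, unit-viscosity Oseen–Duhamel identity, divergence-free slices) with `⟪v, curl v⟫ ≡ 0` on
every slice has SOME slice `s < 0` on which (1) the vorticity is parallel to a fixed `b ≠ 0`, or (2) the slice is
invariant under the translations along a line, or (3) it is axisymmetric without swirl about some axis, or (4) the
vorticity is an affine screw field on a ball.  Each of the four strata is EMPTY OF NONTRIVIAL PROFILES by tree
theorems that conclude `v ≡ 0` on the whole past (`eq_zero_of_aligned`, `eq_zero_of_translate_eq_slice`,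
`eq_zero_of_axisymmetric_noSwirl_anyAxis_slice`, `eq_zero_of_screwVorticityBall`), and conversely the zero profile
lies in stratum (1).  Hence, kernel-checked here:

* `eq_zero_of_sliceDegenerate` / `sliceDegenerate_of_eq_zero` — one profile: a degenerate slice of the four kinds
  ⇔ `v ≡ 0` on `t < 0`;
* `sliceQuadrichotomy_iff_frobeniusLiouville` — **the registered stub is EQUIVALENT to the Liouville theorem for the
  helicity-free class** «every helicity-free profile of the Type-I class vanishes identically» (both written out);
  so S12 carries no classification content beyond Liouville: any proof of the stub proves Liouville on the class,
  and the line `birth` is the crux K2⁗ sandwiched as `Liouville(𝔉) ⇔ stub ⇒ K2⁗`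
  (`frobeniusProfileRigidity_of_frobeniusLiouville`, the last arrow = skeleton composition / `not_backwardSingular_of_zero`);
* `frobeniusLiouville_of_typeIAncientLiouville`, `sliceQuadrichotomy_of_typeIAncientLiouville` — the stub follows
  from (L′) = item stmt-NavierStokesRegularity-4050 `TypeIAncientLiouville` (Type-I ancient Liouville in the KNSS
  gauge, written out verbatim as a hypothesis; the helicity conjunct is simply dropped);
* `frobeniusLiouville_of_liouvilleConjectureNS`, `sliceQuadrichotomy_of_liouvilleConjectureNS` — hence from
  (L) = `LiouvilleConjectureNS` (hard core `TypeIliouvilleL`, stmt-10661) through the tree bridge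
  `typeIAncientLiouville_of_liouvilleConjectureNS`.

Reading for the lead / planner: the stub as registered is `(L′) ∩ 𝔉` — the Type-I ancient Liouville conjecture
restricted to the complex-lamellar class — stated with four vacuous escape hatches; a reshape that names the honest
residue should register «helicity-free profile of the class off the settled strata ⇒ `v ≡ 0`» (cf. the tree's
`frobeniusProfileRigidity_of_sharpest`), exactly as the K2 lead did for `PoloidalWindowRigidity`.

WHAT THIS IS NOT: not a claim about Navier–Stokes regularity, not K2⁗ and not the stub — an unconditional
equivalence plus two CONDITIONAL reductions (hypotheses (L′), (L) explicit; nothing open is asserted).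
bears_on LADDER-NS N0, door S11.
-/

noncomputable section

-- the summit and its single sub-problem share the name (CONVENTIONS §1), as in every Theorems file
set_option linter.dupNamespace false

namespace Summit.NavierStokesRegularity.NavierStokesRegularity.Theorems.LocalHelicityTubeDoorFrobeniusProfileRigiditySliceLiouville

open MeasureTheory Set Function Filter Topology TopologicalSpace Metric
open scoped RealInnerProductSpace InnerProductSpace
open Literature.Analysis Literature.Analysis.FluidPDE
open Summit.NavierStokesRegularity.NavierStokesRegularity.Theorems.PoloidalWindowDoorPoloidalWindowRigidityWindow
open Summit.NavierStokesRegularity.NavierStokesRegularity.Theorems.PoloidalWindowDoorPoloidalWindowRigidityFlat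
open Summit.NavierStokesRegularity.NavierStokesRegularity.Theorems.PoloidalWindowDoorPoloidalWindowRigidityStrata
open Summit.NavierStokesRegularity.NavierStokesRegularity.Theorems.PoloidalWindowDoorPoloidalWindowRigidityOneSlice
open Summit.NavierStokesRegularity.NavierStokesRegularity.Theorems.LocalHelicityTubeDoorFrobeniusProfileRigiditySharper
open Summit.NavierStokesRegularity.NavierStokesRegularity.Theorems.LocalHelicityTubeDoorFrobeniusProfileRigidityScrewSlice

variable {C : ℝ} {v : ℝ → EuclideanSpace ℝ (Fin 3) → EuclideanSpace ℝ (Fin 3)}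

/-! ### One profile: a degenerate slice of the four kinds ⇔ the profile vanishes -/

/-- **Each of the four strata of the slice quadrichotomy forces `v ≡ 0`.**  For a profile of the Type-I class (rate,
continuity, Oseen–Duhamel identity, divergence-free slices) and a slice `s < 0` on which the vorticity is parallel to a
fixed `b ≠ 0`, OR the slice is invariant under translations along some `e ≠ 0`, OR it is axisymmetric without swirl about
some axis `c + ℝ·L e₃`, OR the vorticity is an affine screw field `k • (d × (y − c) + h • d)` on a nonempty open set
(`k ≠ 0`, `d ≠ 0`), the profile vanishes on the whole past (tree strata theorems; the helicity hypothesis is not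
needed). -/
theorem eq_zero_of_sliceDegenerate (hrate : HasTypeITimeDecay C v)
    (hcont : ContinuousOn (uncurry v) (Iio (0 : ℝ) ×ˢ univ))
    (hmild : ∀ s t : ℝ, s < t → t < 0 → ∀ x,
      v t x = UnboundedOperators.heatExtension (v s) (t - s) x - oseenDuhamel 1 s v v t x)
    (hdiv : ∀ t < 0, VectorCalculus.IsDivFree (v t)) {s : ℝ} (hs : s < 0)
    (halt : (∃ b : EuclideanSpace ℝ (Fin 3), b ≠ 0 ∧ ∀ y, cross (curl (v s) y) b = 0) ∨
      (∃ e : EuclideanSpace ℝ (Fin 3), e ≠ 0 ∧ ∀ (y : EuclideanSpace ℝ (Fin 3)) (l : ℝ), v s (y + l • e) = v s y) ∨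
      (∃ (L : EuclideanSpace ℝ (Fin 3) ≃ₗᵢ[ℝ] EuclideanSpace ℝ (Fin 3)) (c : EuclideanSpace ℝ (Fin 3)),
        IsAxisymmetric (fun y => L.symm (v s (L y + c))) ∧ HasNoSwirl (fun y => L.symm (v s (L y + c)))) ∨
      (∃ (k : ℝ) (c d : EuclideanSpace ℝ (Fin 3)) (h : ℝ) (U : Set (EuclideanSpace ℝ (Fin 3))),
        k ≠ 0 ∧ d ≠ 0 ∧ IsOpen U ∧ U.Nonempty ∧
        ∀ y ∈ U, curl (v s) y = k • (cross d (y - c) + h • d))) :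
    ∀ t < 0, ∀ x, v t x = 0 := by
  rcases halt with ⟨b, hb, hal⟩ | ⟨e, he, htr⟩ | ⟨L, c, hax, hsw⟩ | ⟨k, c, d, h, U, -, -, hU, hne, hscrew⟩
  · exact eq_zero_of_aligned hrate hcont hmild hdiv hb hs hal
  · exact eq_zero_of_translate_eq_slice hrate hcont hmild hdiv hs he htr
  · exact eq_zero_of_axisymmetric_noSwirl_anyAxis_slice hrate hcont hmild hdiv L c hs hax hsw
  · exact eq_zero_of_screwVorticityBall hrate hcont hmild hdiv hs k c d h hU hne hscrew

/-- The vorticity of an identically vanishing slice vanishes. -/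
theorem curl_eq_zero_of_slice_eq_zero {s : ℝ} (hzero : ∀ x, v s x = 0) (y : EuclideanSpace ℝ (Fin 3)) :
    curl (v s) y = 0 := by
  have hvs : v s = fun _ => (0 : EuclideanSpace ℝ (Fin 3)) := funext hzero
  rw [hvs]
  ext i
  fin_cases i <;> simp [curl]

/-- **Conversely, the zero profile has a degenerate slice** — its vorticity is parallel to `e₀` (stratum (1)) on EVERY
slice. -/
theorem sliceDegenerate_of_eq_zero (hzero : ∀ t < 0, ∀ x, v t x = 0) {s : ℝ} (hs : s < 0) :
    ∃ b : EuclideanSpace ℝ (Fin 3), b ≠ 0 ∧ ∀ y, cross (curl (v s) y) b = 0 := by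
  refine ⟨EuclideanSpace.single 0 1, ?_, fun y => ?_⟩
  · intro h0
    have := congrArg (fun w : EuclideanSpace ℝ (Fin 3) => w 0) h0
    simp at this
  · rw [curl_eq_zero_of_slice_eq_zero (hzero s hs) y]
    simp [cross]

/-! ### The registered stub ⇔ Liouville on the helicity-free class -/

/-- **THE SLICE QUADRICHOTOMY (registered stub `stub_sliceQuadrichotomy` of the K2⁗ skeleton, bodies verbatim) IS
EQUIVALENT TO THE LIOUVILLE THEOREM FOR THE HELICITY-FREE TYPE-I ANCIENT MILD CLASS.**  Left: every helicity-free profile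
of the class has a slice `s < 0` lying in one of the four strata.  Right: every helicity-free profile of the class
vanishes identically on `t < 0`.  (→: the four strata are empty of nontrivial profiles, `eq_zero_of_sliceDegenerate`;
←: the zero profile is in stratum (1) at `s = −1`.)  Consequently the stub has no content beyond Liouville: a proof of
it is a proof of «(L′) restricted to `⟪v, curl v⟫ ≡ 0`». -/
theorem sliceQuadrichotomy_iff_frobeniusLiouville :
    (∀ (C : ℝ) (v : ℝ → EuclideanSpace ℝ (Fin 3) → EuclideanSpace ℝ (Fin 3)),
      (Literature.Analysis.FluidPDE.HasTypeITimeDecay C v ∧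
        ContinuousOn (Function.uncurry v) (Set.Iio (0 : ℝ) ×ˢ Set.univ) ∧
        (∀ s t : ℝ, s < t → t < 0 → ∀ x, v t x =
          Literature.Analysis.UnboundedOperators.heatExtension (v s) (t - s) x -
            Literature.Analysis.FluidPDE.oseenDuhamel 1 s v v t x) ∧
        (∀ t < 0, Literature.Analysis.FluidPDE.VectorCalculus.IsDivFree (v t)) ∧
        (∀ s < 0, ∀ y : EuclideanSpace ℝ (Fin 3),
          inner ℝ (v s y) (Literature.Analysis.FluidPDE.curl (v s) y) = 0)) →
      ∃ s < 0,
        (∃ b : EuclideanSpace ℝ (Fin 3), b ≠ 0 ∧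
          ∀ y, Literature.Analysis.FluidPDE.cross (Literature.Analysis.FluidPDE.curl (v s) y) b = 0) ∨
        (∃ e : EuclideanSpace ℝ (Fin 3), e ≠ 0 ∧ ∀ (y : EuclideanSpace ℝ (Fin 3)) (l : ℝ), v s (y + l • e) = v s y) ∨
        (∃ (L : EuclideanSpace ℝ (Fin 3) ≃ₗᵢ[ℝ] EuclideanSpace ℝ (Fin 3)) (c : EuclideanSpace ℝ (Fin 3)),
          Literature.Analysis.FluidPDE.IsAxisymmetric (fun y => L.symm (v s (L y + c))) ∧
          Literature.Analysis.FluidPDE.HasNoSwirl (fun y => L.symm (v s (L y + c)))) ∨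
        (∃ (k : ℝ) (c d : EuclideanSpace ℝ (Fin 3)) (h : ℝ) (U : Set (EuclideanSpace ℝ (Fin 3))),
          k ≠ 0 ∧ d ≠ 0 ∧ IsOpen U ∧ U.Nonempty ∧
          ∀ y ∈ U, Literature.Analysis.FluidPDE.curl (v s) y =
            k • (Literature.Analysis.FluidPDE.cross d (y - c) + h • d))) ↔
    (∀ (C : ℝ) (v : ℝ → EuclideanSpace ℝ (Fin 3) → EuclideanSpace ℝ (Fin 3)),
      (Literature.Analysis.FluidPDE.HasTypeITimeDecay C v ∧
        ContinuousOn (Function.uncurry v) (Set.Iio (0 : ℝ) ×ˢ Set.univ) ∧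
        (∀ s t : ℝ, s < t → t < 0 → ∀ x, v t x =
          Literature.Analysis.UnboundedOperators.heatExtension (v s) (t - s) x -
            Literature.Analysis.FluidPDE.oseenDuhamel 1 s v v t x) ∧
        (∀ t < 0, Literature.Analysis.FluidPDE.VectorCalculus.IsDivFree (v t)) ∧
        (∀ s < 0, ∀ y : EuclideanSpace ℝ (Fin 3),
          inner ℝ (v s y) (Literature.Analysis.FluidPDE.curl (v s) y) = 0)) →
      ∀ t < 0, ∀ x, v t x = 0) := by
  constructor
  · intro h C v hcls
    obtain ⟨s, hs, halt⟩ := h C v hcls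
    obtain ⟨hrate, hcont, hmild, hdiv, -⟩ := hcls
    exact eq_zero_of_sliceDegenerate hrate hcont hmild hdiv hs halt
  · intro h C v hcls
    exact ⟨-1, by norm_num, Or.inl (sliceDegenerate_of_eq_zero (h C v hcls) (by norm_num))⟩

/-- **Liouville on the helicity-free class ⇒ K2⁗ (profile form, verbatim the route decl's body)**: a profile vanishing
on the past is not backward-singular at the apex (`not_backwardSingular_of_zero`). -/
theorem frobeniusProfileRigidity_of_frobeniusLiouville
    (h : ∀ (C : ℝ) (v : ℝ → EuclideanSpace ℝ (Fin 3) → EuclideanSpace ℝ (Fin 3)),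
      (Literature.Analysis.FluidPDE.HasTypeITimeDecay C v ∧
        ContinuousOn (Function.uncurry v) (Set.Iio (0 : ℝ) ×ˢ Set.univ) ∧
        (∀ s t : ℝ, s < t → t < 0 → ∀ x, v t x =
          Literature.Analysis.UnboundedOperators.heatExtension (v s) (t - s) x -
            Literature.Analysis.FluidPDE.oseenDuhamel 1 s v v t x) ∧
        (∀ t < 0, Literature.Analysis.FluidPDE.VectorCalculus.IsDivFree (v t)) ∧
        (∀ s < 0, ∀ y : EuclideanSpace ℝ (Fin 3),
          inner ℝ (v s y) (Literature.Analysis.FluidPDE.curl (v s) y) = 0)) →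
      ∀ t < 0, ∀ x, v t x = 0) :
    ∀ (C : ℝ) (v : ℝ → EuclideanSpace ℝ (Fin 3) → EuclideanSpace ℝ (Fin 3)),
      Literature.Analysis.FluidPDE.HasTypeITimeDecay C v →
      ContinuousOn (Function.uncurry v) (Set.Iio (0 : ℝ) ×ˢ Set.univ) →
      (∀ s t : ℝ, s < t → t < 0 → ∀ x, v t x =
        Literature.Analysis.UnboundedOperators.heatExtension (v s) (t - s) x -
          Literature.Analysis.FluidPDE.oseenDuhamel 1 s v v t x) →
      (∀ t < 0, Literature.Analysis.FluidPDE.VectorCalculus.IsDivFree (v t)) →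
      (∀ s < 0, ∀ y : EuclideanSpace ℝ (Fin 3),
        inner ℝ (v s y) (Literature.Analysis.FluidPDE.curl (v s) y) = 0) →
      ¬ Literature.Analysis.FluidPDE.IsBackwardSingularPoint v 0 :=
  fun C v hrate hcont hmild hdiv hhel => not_backwardSingular_of_zero (h C v ⟨hrate, hcont, hmild, hdiv, hhel⟩)

/-! ### The stub below (L′) and (L) -/

/-- **(L′) ⇒ Liouville on the helicity-free class.**  If the Type-I ancient Liouville statement in the KNSS gauge holds
— hypothesis `hL'`, verbatim the body of item stmt-NavierStokesRegularity-4050 `TypeIAncientLiouville` (jointly smooth,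
divergence-free, Oseen-mild with the in-tree `oseenKernel`, time-Type-I ⇒ `u ≡ 0`) — then every helicity-free profile
of the Type-I class vanishes identically (the class is KNSS's, `isTypeIAncientMild_of_class` + `isTypeIAncientMild_iff`;
the helicity conjunct is dropped).  CONDITIONAL on (L′): nothing is asserted about it. -/
theorem frobeniusLiouville_of_typeIAncientLiouville
    (hL' : ∀ (C : ℝ) (u : ℝ → EuclideanSpace ℝ (Fin 3) → EuclideanSpace ℝ (Fin 3)),
      ContDiffOn ℝ (⊤ : ℕ∞) (Function.uncurry u) (Set.Iio 0 ×ˢ Set.univ) ∧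
      (∀ t < 0, Literature.Analysis.FluidPDE.VectorCalculus.IsDivFree (u t)) ∧
      (∀ s t : ℝ, s < t → t < 0 → ∀ x,
        u t x = Literature.Analysis.FluidPDE.heatFlow (u s) (t - s) x -
          ∫ τ in Set.Ioo s t, ∫ y,
            Literature.Analysis.FluidPDE.oseenKernel (t - τ) (x - y) (u τ y) (u τ y)) ∧
      Literature.Analysis.FluidPDE.HasTypeITimeDecay C u →
      ∀ t < 0, ∀ x, u t x = 0) :
    ∀ (C : ℝ) (v : ℝ → EuclideanSpace ℝ (Fin 3) → EuclideanSpace ℝ (Fin 3)),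
      (Literature.Analysis.FluidPDE.HasTypeITimeDecay C v ∧
        ContinuousOn (Function.uncurry v) (Set.Iio (0 : ℝ) ×ˢ Set.univ) ∧
        (∀ s t : ℝ, s < t → t < 0 → ∀ x, v t x =
          Literature.Analysis.UnboundedOperators.heatExtension (v s) (t - s) x -
            Literature.Analysis.FluidPDE.oseenDuhamel 1 s v v t x) ∧
        (∀ t < 0, Literature.Analysis.FluidPDE.VectorCalculus.IsDivFree (v t)) ∧
        (∀ s < 0, ∀ y : EuclideanSpace ℝ (Fin 3),
          inner ℝ (v s y) (Literature.Analysis.FluidPDE.curl (v s) y) = 0)) →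
      ∀ t < 0, ∀ x, v t x = 0 := by
  rintro C v ⟨hrate, hcont, hmild, hdiv, -⟩
  exact hL' C v (isTypeIAncientMild_iff.1 (isTypeIAncientMild_of_class hrate hcont hmild hdiv))

/-- **(L′) ⇒ the registered stub** (`sliceQuadrichotomy_iff_frobeniusLiouville` ∘
`frobeniusLiouville_of_typeIAncientLiouville`).  CONDITIONAL on (L′) = stmt-NavierStokesRegularity-4050. -/
theorem sliceQuadrichotomy_of_typeIAncientLiouville
    (hL' : ∀ (C : ℝ) (u : ℝ → EuclideanSpace ℝ (Fin 3) → EuclideanSpace ℝ (Fin 3)),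
      ContDiffOn ℝ (⊤ : ℕ∞) (Function.uncurry u) (Set.Iio 0 ×ˢ Set.univ) ∧
      (∀ t < 0, Literature.Analysis.FluidPDE.VectorCalculus.IsDivFree (u t)) ∧
      (∀ s t : ℝ, s < t → t < 0 → ∀ x,
        u t x = Literature.Analysis.FluidPDE.heatFlow (u s) (t - s) x -
          ∫ τ in Set.Ioo s t, ∫ y,
            Literature.Analysis.FluidPDE.oseenKernel (t - τ) (x - y) (u τ y) (u τ y)) ∧
      Literature.Analysis.FluidPDE.HasTypeITimeDecay C u →
      ∀ t < 0, ∀ x, u t x = 0) :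
    ∀ (C : ℝ) (v : ℝ → EuclideanSpace ℝ (Fin 3) → EuclideanSpace ℝ (Fin 3)),
      (Literature.Analysis.FluidPDE.HasTypeITimeDecay C v ∧
        ContinuousOn (Function.uncurry v) (Set.Iio (0 : ℝ) ×ˢ Set.univ) ∧
        (∀ s t : ℝ, s < t → t < 0 → ∀ x, v t x =
          Literature.Analysis.UnboundedOperators.heatExtension (v s) (t - s) x -
            Literature.Analysis.FluidPDE.oseenDuhamel 1 s v v t x) ∧
        (∀ t < 0, Literature.Analysis.FluidPDE.VectorCalculus.IsDivFree (v t)) ∧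
        (∀ s < 0, ∀ y : EuclideanSpace ℝ (Fin 3),
          inner ℝ (v s y) (Literature.Analysis.FluidPDE.curl (v s) y) = 0)) →
      ∃ s < 0,
        (∃ b : EuclideanSpace ℝ (Fin 3), b ≠ 0 ∧
          ∀ y, Literature.Analysis.FluidPDE.cross (Literature.Analysis.FluidPDE.curl (v s) y) b = 0) ∨
        (∃ e : EuclideanSpace ℝ (Fin 3), e ≠ 0 ∧ ∀ (y : EuclideanSpace ℝ (Fin 3)) (l : ℝ), v s (y + l • e) = v s y) ∨
        (∃ (L : EuclideanSpace ℝ (Fin 3) ≃ₗᵢ[ℝ] EuclideanSpace ℝ (Fin 3)) (c : EuclideanSpace ℝ (Fin 3)),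
          Literature.Analysis.FluidPDE.IsAxisymmetric (fun y => L.symm (v s (L y + c))) ∧
          Literature.Analysis.FluidPDE.HasNoSwirl (fun y => L.symm (v s (L y + c)))) ∨
        (∃ (k : ℝ) (c d : EuclideanSpace ℝ (Fin 3)) (h : ℝ) (U : Set (EuclideanSpace ℝ (Fin 3))),
          k ≠ 0 ∧ d ≠ 0 ∧ IsOpen U ∧ U.Nonempty ∧
          ∀ y ∈ U, Literature.Analysis.FluidPDE.curl (v s) y =
            k • (Literature.Analysis.FluidPDE.cross d (y - c) + h • d)) :=
  sliceQuadrichotomy_iff_frobeniusLiouville.2 (frobeniusLiouville_of_typeIAncientLiouville hL')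

/-- **(L) ⇒ Liouville on the helicity-free class**, through the tree bridge (L) ⇒ (L′)
(`typeIAncientLiouville_of_liouvilleConjectureNS`).  CONDITIONAL on (L) = `LiouvilleConjectureNS` (the hard core
`TypeIliouvilleL`, stmt-NavierStokesRegularity-10661, is definitionally the same statement). -/
theorem frobeniusLiouville_of_liouvilleConjectureNS
    (hL : Summit.NavierStokesRegularity.NavierStokesRegularity.LiouvilleConjectureNS) :
    ∀ (C : ℝ) (v : ℝ → EuclideanSpace ℝ (Fin 3) → EuclideanSpace ℝ (Fin 3)),
      (Literature.Analysis.FluidPDE.HasTypeITimeDecay C v ∧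
        ContinuousOn (Function.uncurry v) (Set.Iio (0 : ℝ) ×ˢ Set.univ) ∧
        (∀ s t : ℝ, s < t → t < 0 → ∀ x, v t x =
          Literature.Analysis.UnboundedOperators.heatExtension (v s) (t - s) x -
            Literature.Analysis.FluidPDE.oseenDuhamel 1 s v v t x) ∧
        (∀ t < 0, Literature.Analysis.FluidPDE.VectorCalculus.IsDivFree (v t)) ∧
        (∀ s < 0, ∀ y : EuclideanSpace ℝ (Fin 3),
          inner ℝ (v s y) (Literature.Analysis.FluidPDE.curl (v s) y) = 0)) →
      ∀ t < 0, ∀ x, v t x = 0 :=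
  frobeniusLiouville_of_typeIAncientLiouville
    (FrequencyRigidity.TwoEndedPinning.typeIAncientLiouville_of_liouvilleConjectureNS hL)

/-- **(L) ⇒ the registered stub.**  CONDITIONAL on (L) = `LiouvilleConjectureNS`. -/
theorem sliceQuadrichotomy_of_liouvilleConjectureNS
    (hL : Summit.NavierStokesRegularity.NavierStokesRegularity.LiouvilleConjectureNS) :
    ∀ (C : ℝ) (v : ℝ → EuclideanSpace ℝ (Fin 3) → EuclideanSpace ℝ (Fin 3)),
      (Literature.Analysis.FluidPDE.HasTypeITimeDecay C v ∧
        ContinuousOn (Function.uncurry v) (Set.Iio (0 : ℝ) ×ˢ Set.univ) ∧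
        (∀ s t : ℝ, s < t → t < 0 → ∀ x, v t x =
          Literature.Analysis.UnboundedOperators.heatExtension (v s) (t - s) x -
            Literature.Analysis.FluidPDE.oseenDuhamel 1 s v v t x) ∧
        (∀ t < 0, Literature.Analysis.FluidPDE.VectorCalculus.IsDivFree (v t)) ∧
        (∀ s < 0, ∀ y : EuclideanSpace ℝ (Fin 3),
          inner ℝ (v s y) (Literature.Analysis.FluidPDE.curl (v s) y) = 0)) →
      ∃ s < 0,
        (∃ b : EuclideanSpace ℝ (Fin 3), b ≠ 0 ∧
          ∀ y, Literature.Analysis.FluidPDE.cross (Literature.Analysis.FluidPDE.curl (v s) y) b = 0) ∨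
        (∃ e : EuclideanSpace ℝ (Fin 3), e ≠ 0 ∧ ∀ (y : EuclideanSpace ℝ (Fin 3)) (l : ℝ), v s (y + l • e) = v s y) ∨
        (∃ (L : EuclideanSpace ℝ (Fin 3) ≃ₗᵢ[ℝ] EuclideanSpace ℝ (Fin 3)) (c : EuclideanSpace ℝ (Fin 3)),
          Literature.Analysis.FluidPDE.IsAxisymmetric (fun y => L.symm (v s (L y + c))) ∧
          Literature.Analysis.FluidPDE.HasNoSwirl (fun y => L.symm (v s (L y + c)))) ∨
        (∃ (k : ℝ) (c d : EuclideanSpace ℝ (Fin 3)) (h : ℝ) (U : Set (EuclideanSpace ℝ (Fin 3))),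
          k ≠ 0 ∧ d ≠ 0 ∧ IsOpen U ∧ U.Nonempty ∧
          ∀ y ∈ U, Literature.Analysis.FluidPDE.curl (v s) y =
            k • (Literature.Analysis.FluidPDE.cross d (y - c) + h • d)) :=
  sliceQuadrichotomy_of_typeIAncientLiouville
    (FrequencyRigidity.TwoEndedPinning.typeIAncientLiouville_of_liouvilleConjectureNS hL)

end Summit.NavierStokesRegularity.NavierStokesRegularity.Theorems.LocalHelicityTubeDoorFrobeniusProfileRigiditySliceLiouville

end
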